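import Literature.NumberTheory.Transcendental.ManyCurveEngineG
import Literature.NumberTheory.Transcendental.BakerNumericsG
import HarnessLib

/-!
# Baker's method on the `k`-lattice standard models at a general algebraic point: closing data, numerics, the engine output

Topic `Literature/NumberTheory/Transcendental`; a proofs-and-definitions file (no named facts) towards the
Semistability Theorem (Baker–Wüstholz 2007, Thm. 6.15) for the FAMILY standard models `M = 𝔾ₘ^β × P` at ALL
algebraic points, after `ManyCurveBakerG.lean`, `ManyCurveSiegelG.lean`, `ManyCurveEngineG.lean`.  It is the family
twin of `BakerNumericsG.lean` Parts I and III (one lattice, all algebraic points) together with the engine output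
of `SemistabilityStdOfPhilippon.engine_of_reduced`:

* `GaGmEFam.Std.exists_reduced_multiple` (blockwise lattices), `exists_bakerDataG` (the data at a reduced
  algebraic point with `dd = dim 𝔟` directions spanning `𝔟`), `AdmissibleParamsG` (the admissible-parameter
  predicate of the scaled engine, DISCHARGED below);
* `numCond₂_familyG` and **`admissibleParamsG_of_lt`** — the numerical condition along the exponential parameter
  family `GaGmE.Std.BakerDataG.FamilyG` of `BakerNumericsG.lean` (lattice-independent, imported, not restated);
* **`GaGmEFam.Std.engine_of_reduced`** — the engine output at every reduced algebraic point of every family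
  standard model: the hypothesis of the first-run dichotomy of Baker's method at general points.

Everything is proved; no named facts (`AdmissibleParamsG` is a predicate with arguments, used as an explicit
hypothesis and discharged).

## References

* A. Baker, G. Wüstholz, *Logarithmic Forms and Diophantine Geometry*, CUP 2007, §6.8 (pp. 117–119).
  [BakerWustholz2007]
-/

noncomputable section

open Module Submodule Complex
open scoped PeriodPair

namespace Literature.NumberTheory.Transcendental

namespace GaGmEFam

namespace Std

open GaGmE (Kbar)
open GaGmE.Std (iy iz is coords coords_iy coords_iz coords_is sum_blocks ThetaIdx thetaT thetaT_none
  thetaT_some differentiable_thetaT VanishesAlong isAlgebraic_coe_Kbar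
  Gen factorGen zetaHat zetaHatDer factorODE zetaHatODE FactorChartValid isOpen_factorChartValid
  factorGen_false factorGen_true zetaHat_false zetaHat_true hasDerivAt_zetaHat
  baseFin baseIdx rPoly corrPoly TPoly rVal corrVal factor_blocks line_apply genFin genIdx
  rVal_baseFin corrVal_baseFin rVal_genFin genericChart affGen affIdx homog isHomogeneous_homog
  eval_homog_of_base_eq_one factorODEᵣ zetaHatODEᵣ rPolyᵣ corrPolyᵣ TPolyᵣ homogMonomialᵣ
  map_homogMonomialᵣ homog_monomial homog_add homog_zero homog_sum homog_eq_sum)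
open GaGmE.Std.BakerDataG (FamilyG)

open LiePresentation

variable {𝓙 : Type} [Fintype 𝓙] [DecidableEq 𝓙] {β γ δ : Type} [Fintype β] [Fintype γ] [Fintype δ] [DecidableEq γ]

omit [Fintype 𝓙] [DecidableEq 𝓙] [Fintype β] [Fintype δ] [DecidableEq γ] in
/-- **Reduced multiples (blockwise lattices).** Every `w ∈ Lie M_ℂ` has a multiple `N·w`, `N ≥ 1`, each of
whose `E`-coordinates is a vector of the lattice `Λ_{cls b}` of its block or has no torsion there
(`s·(N z_b) ∉ Λ_{cls b}` for all `s ≥ 1`): take `N` the product of the torsion orders of the torsion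
coordinates. [folklore] -/
theorem exists_reduced_multiple (L : 𝓙 → PeriodPair) (cls : γ → 𝓙) (w : β ⊕ (γ ⊕ δ) → ℂ) :
    ∃ N : ℕ, 0 < N ∧ ∀ b, ((N : ℂ) • w) (iz b) ∈ (L (cls b)).lattice ∨
      ∀ s : ℕ, s ≠ 0 → (s : ℂ) * ((N : ℂ) • w) (iz b) ∉ (L (cls b)).lattice := by
  classical
  -- per-coordinate torsion orders (`1` for a non-torsion coordinate)
  have hco : ∀ b, ∃ nb : ℕ, 0 < nb ∧ ((∃ m : ℕ, m ≠ 0 ∧ (m : ℂ) * w (iz b) ∈ (L (cls b)).lattice) →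
      (nb : ℂ) * w (iz b) ∈ (L (cls b)).lattice) := by
    intro b
    by_cases h : ∃ m : ℕ, m ≠ 0 ∧ (m : ℂ) * w (iz b) ∈ (L (cls b)).lattice
    · obtain ⟨m, hm, hmem⟩ := h
      exact ⟨m, Nat.pos_of_ne_zero hm, fun _ => hmem⟩
    · exact ⟨1, one_pos, fun h' => absurd h' h⟩
  choose nb hnb hmem using hco
  refine ⟨∏ b, nb b, Finset.prod_pos fun b _ => hnb b, fun b => ?_⟩
  simp only [Pi.smul_apply, smul_eq_mul]
  by_cases h : ∃ m : ℕ, m ≠ 0 ∧ (m : ℂ) * w (iz b) ∈ (L (cls b)).lattice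
  · left
    rw [← Finset.mul_prod_erase Finset.univ nb (Finset.mem_univ b)]
    push_cast
    rw [mul_comm ((nb b : ℂ)), mul_assoc]
    have := (L (cls b)).lattice.smul_mem ((∏ b' ∈ Finset.univ.erase b, nb b' : ℕ) : ℤ) (hmem b h)
    simpa [zsmul_eq_mul] using this
  · right
    intro s hs hsm
    push Not at h
    apply h (s * ∏ b', nb b') (Nat.mul_ne_zero hs (Finset.prod_ne_zero_iff.mpr fun b' _ => (hnb b').ne'))
    push_cast
    rw [mul_assoc]
    exact_mod_cast hsm

/-- **The general-point Baker data of the closing argument.** For `Λ` with algebraic invariants,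
a `ℚ̄`-rational `𝔟` and a REDUCED `w ∈ Std.Alg`, there is a `BakerDataG` with period pair `L`,
extension data `κ`, point `v = w`, `dd = dim 𝔟` directions spanning exactly `𝔟`.
[cite: BakerWustholz2007, §6.8 (p. 118: the data of the construction)] -/
theorem exists_bakerDataG (L : 𝓙 → PeriodPair) (cls : γ → 𝓙) (hL : ∀ i, IsAlgebraic ℚ (L i).g₂ ∧ IsAlgebraic ℚ (L i).g₃)
    (κM : δ → γ → Kbar) {𝔟 : Submodule ℂ (β ⊕ (γ ⊕ δ) → ℂ)} (hrat : IsKRational Kbar 𝔟)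
    {w : β ⊕ (γ ⊕ δ) → ℂ} (hw : w ∈ Alg L cls κM)
    (hred : ∀ b, w (iz b) ∈ (L (cls b)).lattice ∨ ∀ s : ℕ, s ≠ 0 → (s : ℂ) * w (iz b) ∉ (L (cls b)).lattice) :
    ∃ B : BakerDataG 𝓙 β γ δ, B.L = L ∧ B.cls = cls ∧ B.κM = κM ∧ B.v = w ∧ B.dd = Module.finrank ℂ 𝔟 ∧
      Submodule.span ℂ (Set.range B.xs) = 𝔟 := by
  classical
  obtain ⟨b, -, hspan⟩ := hrat.exists_basis_ofK Kbar
  obtain ⟨hy, t', ht', ha⟩ := hw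
  -- lattice coordinates of the lattice `E`-coordinates
  have hco : ∀ b', ∃ o : Option (ℤ × ℤ),
      (∀ mn, o = some mn → w (iz b') = (mn.1 : ℂ) * (L (cls b')).ω₁ + (mn.2 : ℂ) * (L (cls b')).ω₂) ∧
      (o = none → ∀ s : ℕ, s ≠ 0 → (s : ℂ) * w (iz b') ∉ (L (cls b')).lattice) := by
    intro b'
    rcases hred b' with h | h
    · obtain ⟨m, n, hmn⟩ := PeriodPair.mem_lattice.mp h
      refine ⟨some (m, n), fun mn hmn' => ?_, fun h0 => ?_⟩
      · simp only [Option.some.injEq] at hmn'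
        subst hmn'
        exact hmn.symm
      · exact absurd h0 (by simp)
    · exact ⟨none, ⟨fun mn h0 => absurd h0 (by simp), fun _ => h⟩⟩
  choose latCo hlat hnt using hco
  let B : BakerDataG 𝓙 β γ δ :=
    { L := L
      cls := cls
      κM := κM
      hL := hL
      v := w
      hy := hy
      t' := t'
      ht' := ht'
      ha := ha
      latCo := latCo
      hlat := hlat
      hnt := hnt
      dd := Module.finrank ℂ 𝔟
      xs := fun m => ofK Kbar (b m)
      hxs := fun m k => isAlgebraic_coe_Kbar (b m k) }
  exact ⟨B, rfl, rfl, rfl, rfl, rfl, hspan⟩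

variable [DecidableEq β] [DecidableEq δ]

/-- The admissible-parameter predicate of the scaled engine `BakerDataG.engine₂` for the general-point
datum `B` and the constant `c > 0` (word for word `ClosingDichotomy.AdmissibleParams`): parameters
`D', T, S₀, S, T″, R` with `T ≥ 1`, `D' ≥ 1`, `S ≥ 1`, Siegel feasibility, `R ≥ 2(nS + S₀) > 0`, the
numerical condition `NumCond₂` for every coefficient vector within the Siegel bound (`S₁ = nS`,
`T' = nT″ + 1`), and the zero-estimate numerics. Discharged in the sequel (`admissibleParamsG_of_lt`).
[cite: BakerWustholz2007, §6.8 (p. 119: choice of D, T, S)] -/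
def AdmissibleParamsG (B : BakerDataG 𝓙 β γ δ) (d𝔟 : ℕ) (c : ℝ) : Prop :=
  ∃ (D' T S₀ S T'' : ℕ) (R : ℝ), 0 < T ∧ 1 ≤ D' ∧ 1 ≤ S ∧
    (S₀ + 1) * T ^ B.dd < (D' + 1) ^ Fintype.card (β ⊕ (γ ⊕ δ)) ∧ 0 < R ∧
    2 * (((Fintype.card (β ⊕ (γ ⊕ δ)) * S : ℕ) : ℝ) + S₀) ≤ R ∧
    (∀ ξ : GaGmE.Std.BakerData.UIdx β γ δ D' → NumberField.RingOfIntegers B.K,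
      (∀ u, NumberField.house ((ξ u : NumberField.RingOfIntegers B.K) : B.K) ≤ B.siegelHouseBound D' T S₀) →
        B.NumCond₂ ξ T S₀ (Fintype.card (β ⊕ (γ ⊕ δ)) * S) (Fintype.card (β ⊕ (γ ⊕ δ)) * T'' + 1) R) ∧
    ∀ e m : ℕ, m < Fintype.card (β ⊕ (γ ⊕ δ)) → d𝔟 * (Fintype.card (β ⊕ (γ ⊕ δ)) - m) ≤ e * Fintype.card (β ⊕ (γ ⊕ δ)) →
      c * ((Fintype.card (β ⊕ (γ ⊕ δ)) * D' : ℕ) : ℝ) ^ Fintype.card (β ⊕ (γ ⊕ δ)) <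
          (Nat.choose (T'' + e) e : ℝ) * ((S : ℝ) + 1) * ((Fintype.card (β ⊕ (γ ⊕ δ)) * D' : ℕ) : ℝ) ^ m ∧
      (d𝔟 * (Fintype.card (β ⊕ (γ ⊕ δ)) - m) < e * Fintype.card (β ⊕ (γ ⊕ δ)) →
        c * ((Fintype.card (β ⊕ (γ ⊕ δ)) * D' : ℕ) : ℝ) ^ Fintype.card (β ⊕ (γ ⊕ δ)) <
          (Nat.choose (T'' + e) e : ℝ) * ((Fintype.card (β ⊕ (γ ⊕ δ)) * D' : ℕ) : ℝ) ^ m)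

end Std

end GaGmEFam

end Literature.NumberTheory.Transcendental

end

noncomputable section

open Complex MvPolynomial Finset NumberField
open scoped PeriodPair

namespace Literature.NumberTheory.Transcendental

namespace GaGmEFam

namespace Std

open GaGmE (Kbar)
open GaGmE.Std (iy iz is coords coords_iy coords_iz coords_is sum_blocks ThetaIdx thetaT thetaT_none
  thetaT_some differentiable_thetaT VanishesAlong isAlgebraic_coe_Kbar
  Gen factorGen zetaHat zetaHatDer factorODE zetaHatODE FactorChartValid isOpen_factorChartValid
  factorGen_false factorGen_true zetaHat_false zetaHat_true hasDerivAt_zetaHat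
  baseFin baseIdx rPoly corrPoly TPoly rVal corrVal factor_blocks line_apply genFin genIdx
  rVal_baseFin corrVal_baseFin rVal_genFin genericChart affGen affIdx homog isHomogeneous_homog
  eval_homog_of_base_eq_one factorODEᵣ zetaHatODEᵣ rPolyᵣ corrPolyᵣ TPolyᵣ homogMonomialᵣ
  map_homogMonomialᵣ homog_monomial homog_add homog_zero homog_sum homog_eq_sum)
open GaGmE.Std.BakerDataG (FamilyG)

namespace BakerDataG

open GaGmE.Std.BakerData (UIdx νOf νOf_apply νOf_injective degree_νOf_le card_UIdx saving_le lin_quad_le)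
open GaGmE.Std.BakerData.Family (κD S₀ S₀_add_one)



variable {𝓙 : Type} [Fintype 𝓙] [DecidableEq 𝓙] {β γ δ : Type} [Fintype β] [Fintype γ] [Fintype δ] [DecidableEq γ]
variable [DecidableEq β] [DecidableEq δ] (B : BakerDataG 𝓙 β γ δ)

/-- **`NumCond₂` holds along the exponential family** (for `σ` beyond explicit thresholds), for every
coefficient vector within the Siegel house bound. Hypotheses: `n ≥ 1`, `dd < n`,
`b ≥ b₀(n, h, #Gen, ℓ)`, `a ≥ 9(nℓ+1)² + 2b + 2`, the base `G ≥ bigConst`, and the thresholds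
`κ_D ≤ σ`, `18nh(na + E₀) ≤ σ`, `C_D κ_D ≤ σ`. [cite: BakerWustholz2007, §6.8 (p. 119)] -/
theorem numCond₂_familyG (B : BakerDataG 𝓙 β γ δ) (F : FamilyG) {n : ℕ} (hn' : Fintype.card (β ⊕ (γ ⊕ δ)) = n) (hn : 1 ≤ n)
    (hdd : B.dd < n) (hb : F.b₀ n B.gens.h (Fintype.card (Gen β γ δ)) ≤ F.b)
    (ha : 9 * (n * F.ℓ + 1) ^ 2 + 2 * F.b + 2 ≤ F.a) (hGG : B.bigConst ≤ F.G) {σ : ℕ} (hσ : 1 ≤ σ)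
    (hσκ : κD n B.dd ≤ σ) (hσω : 18 * n * B.gens.h * (n * F.a + F.E₀ n B.dd B.hdeg) ≤ σ)
    (hσD : F.CD n B.gens.h B.hdeg (Fintype.card (Gen β γ δ)) * κD n B.dd ≤ σ)
    {ξ : UIdx β γ δ (F.D' n B.dd σ) → 𝓞 B.K}
    (hξ : ∀ u, house ((ξ u : 𝓞 B.K) : B.K) ≤ B.siegelHouseBound (F.D' n B.dd σ) (F.T n σ) (S₀ n σ)) :
    B.NumCond₂ ξ (F.T n σ) (S₀ n σ) (F.S₁ n σ) (F.T' n σ) (F.R n σ) := by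
  -- basic facts about the base
  have hG2 := B.bigConst_spec.1
  have hG1 := B.one_le_bigConst
  set Gr : ℝ := (F.G : ℝ) with hGr
  have hGr2 : (2 : ℝ) ≤ Gr := by rw [hGr]; exact_mod_cast F.hG
  have hGr1 : (1 : ℝ) < Gr := by linarith
  have hGrG : B.bigConst ≤ Gr := hGG
  have h1 : 1 ≤ B.gens.h := B.gens.one_le_h
  set cg := Fintype.card (Gen β γ δ) with hcg
  -- the sizes and `W = Gr^ω`
  set ωσ := F.ω n B.dd B.hdeg σ with hωσ
  set W : ℝ := Gr ^ ωσ with hW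
  have hW1 : (1 : ℝ) ≤ W := one_le_pow₀ hGr1.le
  obtain ⟨sD, sT', sS₁, sS₀, sT, sP⟩ := F.sizes_le_W hn hdd B.hdeg hσ
  have castW : ∀ {m : ℕ}, m ≤ F.G ^ ωσ → (m : ℝ) ≤ W := fun hm => by
    rw [hW, hGr]; exact_mod_cast hm
  have hWD : (F.D' n B.dd σ : ℝ) + 1 ≤ W := by have := castW sD; push_cast at this; exact this
  have hWT' : (F.T' n σ : ℝ) ≤ W := castW sT'
  have hWS₁ : (F.S₁ n σ : ℝ) + 1 ≤ W := by have := castW sS₁; push_cast at this; exact this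
  have hWT : ((Fintype.card (β ⊕ (γ ⊕ δ)) * F.D' n B.dd σ * B.hdeg : ℕ) : ℝ) + 2 * (F.T n σ) + 1 ≤ W := by
    rw [hn']; have := castW sT; push_cast at this ⊢; linarith
  have hWP : ((Fintype.card (β ⊕ (γ ⊕ δ)) * F.D' n B.dd σ * B.hdeg : ℕ) : ℝ) + 2 * (F.T' n σ) ≤ W := by
    rw [hn']; have := castW sP; push_cast at this ⊢; linarith
  have hqp : 2 * ((S₀ n σ + 1) * F.T n σ ^ B.dd) ≤ (F.D' n B.dd σ + 1) ^ Fintype.card (β ⊕ (γ ⊕ δ)) := by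
    rw [hn']; exact F.two_p_le_q n B.dd hn hσ
  have hp : 0 < (S₀ n σ + 1) * F.T n σ ^ B.dd := Nat.mul_pos (Nat.succ_pos _) (pow_pos (F.T_pos n hn σ) _)
  -- `R`, `θ`
  obtain ⟨hR0, hR2⟩ := F.R_bounds n hn hσ
  have hRR' := F.R_le_R' (n := n) hσ
  set θ : ℝ := (Gr ^ (F.b * σ ^ (2 * n)))⁻¹ with hθ
  have hθ1 : θ ≤ 1 := inv_le_one_of_one_le₀ (one_le_pow₀ hGr1.le)
  have hθeq : 2 * ((F.S₁ n σ : ℝ) + S₀ n σ) / F.R n σ ≤ θ := by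
    have hRdef : F.R n σ = Gr ^ (F.b * σ ^ (2 * n)) * (2 * ((F.S₁ n σ : ℝ) + S₀ n σ)) := by
      unfold FamilyG.R FamilyG.S₁; push_cast; rw [hGr]
    have hsum : (0 : ℝ) < 2 * ((F.S₁ n σ : ℝ) + S₀ n σ) := by
      rw [hRdef] at hR0
      have hbpos : (0 : ℝ) < Gr ^ (F.b * σ ^ (2 * n)) := by positivity
      exact (pos_iff_pos_of_mul_pos hR0).mp hbpos
    rw [hRdef, hθ, div_le_iff₀ (by positivity)]
    rw [show (Gr ^ (F.b * σ ^ (2 * n)))⁻¹ * (Gr ^ (F.b * σ ^ (2 * n)) * (2 * ((F.S₁ n σ : ℝ) + S₀ n σ))) =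
      2 * ((F.S₁ n σ : ℝ) + S₀ n σ) from by field_simp]
  intro s hs k hk
  have hk' : k ≤ F.T' n σ := hk.le
  -- the envelopes
  have e1 := B.orderLoss_le hk' hW1 hWT'
  have eU : (Fintype.card (UIdx β γ δ (F.D' n B.dd σ)) : ℝ) ≤ W ^ n := by
    rw [card_UIdx, hn']; push_cast; exact pow_le_pow_left₀ (by positivity) hWD n
  have e3 := B.houseXi_le ξ hξ hW1 hWD hqp hp
  have eA := B.houseBound_le (F.D' n B.dd σ) (F.T n σ) (S₀ n σ) hW1 hWT
  have e4 := B.growth_le (Fintype.card (β ⊕ (γ ⊕ δ)) * F.D' n B.dd σ) hR0.le hRR' hGG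
  have e5 := saving_le (T := F.T n σ) hR0 hθeq hθ1 hs hk'
  have e6 := B.dAt_pow_le (D := Fintype.card (β ⊕ (γ ⊕ δ)) * F.D' n B.dd σ) hs hk'
  have e7 := B.lineValBound_le ξ hξ hW1 hWD hqp hp hWT' hWP hs hk'
  -- rename `card` to `n` in the envelopes and in the goal
  rw [hn'] at e3 eA e4 e6 e7
  rw [hn']
  rw [← hcg] at eA e6
  -- identify the exponents with the `FamilyG` names
  have iET : B.expE (n * F.D' n B.dd σ) (F.T n σ) = F.ET n B.dd B.hdeg σ := rfl
  have iE' : B.expE (n * F.D' n B.dd σ) (F.T' n σ) = F.E' n B.dd B.hdeg σ := rfl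
  rw [iET] at eA
  rw [iE'] at e6
  -- nonnegativity
  have hG0 : (0 : ℝ) ≤ B.bigConst := by linarith
  have hWr0 : (0 : ℝ) ≤ W := by linarith
  have hθ0 : (0 : ℝ) ≤ θ := by rw [hθ]; positivity
  have hA1 := B.one_le_houseBound (F.D' n B.dd σ) (F.T n σ) (S₀ n σ)
  have hA0 : (0 : ℝ) ≤ B.houseBound (F.D' n B.dd σ) (F.T n σ) (S₀ n σ) := zero_le_one.trans hA1
  -- substitute the house bound into `e3`, `e7`
  set EA : ℝ := B.bigConst ^ ((1 + cg * (S₀ n σ + 1) ^ 3) * F.ET n B.dd B.hdeg σ + 2 * F.T n σ + n * F.D' n B.dd σ +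
      (S₀ n σ + 1) ^ 3 * (n * F.D' n B.dd σ * B.hdeg + 2 * F.T n σ)) * W ^ (F.T n σ) with hEA
  have hEA0 : 0 ≤ EA := by rw [hEA]; positivity
  have e3' : B.houseXi ξ ≤ B.bigConst ^ 3 * W ^ (2 * n) * EA :=
    e3.trans (mul_le_mul_of_nonneg_left eA (by positivity))
  have e7' : B.lineValBound ξ s k ≤
      B.bigConst ^ (2 * F.T' n σ + 3 + n * F.D' n B.dd σ + (F.S₁ n σ + 1) ^ 3 * (n * F.D' n B.dd σ * B.hdeg + 2 * F.T' n σ)) *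
        W ^ (2 * F.T' n σ + 3 * n) * EA :=
    e7.trans (mul_le_mul_of_nonneg_left eA (by positivity))
  -- nonnegativity of the true factors
  have nU : (0 : ℝ) ≤ (Fintype.card (UIdx β γ δ (F.D' n B.dd σ)) : ℝ) := Nat.cast_nonneg _
  have nH : (0 : ℝ) ≤ B.houseXi ξ := zero_le_one.trans (B.one_le_houseXi ξ)
  have nG : (0 : ℝ) ≤ Real.exp (thetaGrowthC (β := β) B.L B.cls B.κM * (1 + (F.R n σ * ‖B.v‖ + 1) ^ 2)) ^ (n * F.D' n B.dd σ) :=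
    pow_nonneg (Real.exp_nonneg _) _
  have nS : (0 : ℝ) ≤ (2 * ((s : ℝ) + S₀ n σ) / F.R n σ) ^ ((F.T n σ - k) * (S₀ n σ + 1)) := by positivity
  have nL : (0 : ℝ) ≤ B.lineValBound ξ s k := B.lineValBound_nonneg ξ s k
  -- block 2: `#U · H_ξ · growth`
  have b2 : (Fintype.card (UIdx β γ δ (F.D' n B.dd σ)) : ℝ) * B.houseXi ξ *
        Real.exp (thetaGrowthC (β := β) B.L B.cls B.κM * (1 + (F.R n σ * ‖B.v‖ + 1) ^ 2)) ^ (n * F.D' n B.dd σ) ≤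
      W ^ n * (B.bigConst ^ 3 * W ^ (2 * n) * EA) * B.bigConst ^ (n * F.D' n B.dd σ * (1 + (F.R' n σ + 1) ^ 2 * F.G ^ 2)) :=
    mul_le_mul (mul_le_mul eU e3' nH (by positivity)) e4 nG (by positivity)
  -- block 4: the Liouville factors
  have b4 : |(B.dAt s : ℝ)| ^ B.expE (n * F.D' n B.dd σ) k *
        (|(B.dAt s : ℝ)| ^ B.expE (n * F.D' n B.dd σ) k * B.lineValBound ξ s k) ^ (B.gens.h - 1) ≤
      B.bigConst ^ ((1 + cg * (F.S₁ n σ + 1) ^ 3) * F.E' n B.dd B.hdeg σ) *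
        (B.bigConst ^ ((1 + cg * (F.S₁ n σ + 1) ^ 3) * F.E' n B.dd B.hdeg σ) *
          (B.bigConst ^ (2 * F.T' n σ + 3 + n * F.D' n B.dd σ + (F.S₁ n σ + 1) ^ 3 * (n * F.D' n B.dd σ * B.hdeg + 2 * F.T' n σ)) *
            W ^ (2 * F.T' n σ + 3 * n) * EA)) ^ (B.gens.h - 1) :=
    mul_le_mul e6 (pow_le_pow_left₀ (by positivity) (mul_le_mul e6 e7' nL (by positivity)) _) (by positivity)
      (by positivity)
  -- the whole left-hand side
  have hLHS := mul_le_mul (mul_le_mul (mul_le_mul e1 b2 (by positivity) (by positivity)) e5 nS (by positivity))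
    b4 (by positivity) (by positivity)
  refine lt_of_le_of_lt hLHS ?_
  -- collect the exponents
  obtain ⟨h₁, hh₁⟩ : ∃ h₁, B.gens.h = h₁ + 1 := ⟨B.gens.h - 1, by omega⟩
  have hΘD : F.CD n B.gens.h B.hdeg cg * κD n B.dd * σ ≤ F.Θ n σ := F.ΘD_le hn hσD
  have hΘR : (F.R' n σ + 1) ^ 2 * F.G ^ 2 ≤ F.Θ n σ := F.ΘR_le hσ ha
  have hX := F.exponent_ineq (n := n) (dd := B.dd) (h := B.gens.h) (hdeg := B.hdeg) (cg := cg)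
    hn hdd h1 hb hσ hσκ hσω hΘD hΘR
  have key : B.bigConst ^ (F.X₁ n B.dd B.gens.h B.hdeg cg σ) * W ^ (F.X₂ n B.gens.h σ) * θ ^ (F.Msave n σ) <
      (B.thetaLowc * Real.exp (-(B.thetaLowC * ((s : ℝ) + 1) ^ 3))) ^ (n * F.D' n B.dd σ) := by
    -- right-hand side from below
    have hY : n * F.D' n B.dd σ * (1 + (s + 1) ^ 3) ≤ F.Y n B.dd σ := by
      unfold FamilyG.Y FamilyG.Dn
      exact Nat.mul_le_mul_left _ (Nat.add_le_add_left (Nat.pow_le_pow_left (by omega) 3) 1)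
    have hR := B.rhs_ge (n * F.D' n B.dd σ) s
    have hR' : (Gr ^ F.Y n B.dd σ)⁻¹ ≤ (B.thetaLowc * Real.exp (-(B.thetaLowC * ((s : ℝ) + 1) ^ 3))) ^ (n * F.D' n B.dd σ) := by
      refine le_trans ?_ hR
      rw [inv_le_inv₀ (by positivity) (by positivity)]
      calc B.bigConst ^ (n * F.D' n B.dd σ * (1 + (s + 1) ^ 3)) ≤ Gr ^ (n * F.D' n B.dd σ * (1 + (s + 1) ^ 3)) :=
            pow_le_pow_left₀ hG0 hGrG _
        _ ≤ Gr ^ F.Y n B.dd σ := pow_le_pow_right₀ hGr1.le hY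
    refine lt_of_lt_of_le ?_ hR'
    -- left-hand side from above, as a single power of `Gr`
    have hGX : B.bigConst ^ (F.X₁ n B.dd B.gens.h B.hdeg cg σ) ≤ Gr ^ (F.X₁ n B.dd B.gens.h B.hdeg cg σ) :=
      pow_le_pow_left₀ hG0 hGrG _
    have hpos : (0 : ℝ) < Gr ^ (F.b * σ ^ (2 * n) * F.Msave n σ) := by positivity
    have hposY : (0 : ℝ) < Gr ^ F.Y n B.dd σ := by positivity
    calc B.bigConst ^ (F.X₁ n B.dd B.gens.h B.hdeg cg σ) * W ^ (F.X₂ n B.gens.h σ) * θ ^ (F.Msave n σ)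
        ≤ Gr ^ (F.X₁ n B.dd B.gens.h B.hdeg cg σ) * W ^ (F.X₂ n B.gens.h σ) * θ ^ (F.Msave n σ) :=
          mul_le_mul_of_nonneg_right (mul_le_mul_of_nonneg_right hGX (by positivity)) (by positivity)
      _ = Gr ^ (F.X₁ n B.dd B.gens.h B.hdeg cg σ + ωσ * F.X₂ n B.gens.h σ) *
          (Gr ^ (F.b * σ ^ (2 * n) * F.Msave n σ))⁻¹ := by
          rw [hW, hθ, inv_pow, ← pow_mul, ← pow_mul, pow_add]
      _ < (Gr ^ F.Y n B.dd σ)⁻¹ := by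
          have hmain : Gr ^ (F.X₁ n B.dd B.gens.h B.hdeg cg σ + ωσ * F.X₂ n B.gens.h σ) * Gr ^ F.Y n B.dd σ <
              Gr ^ (F.b * σ ^ (2 * n) * F.Msave n σ) := by
            rw [← pow_add]; exact pow_lt_pow_right₀ hGr1 hX
          rw [inv_eq_one_div (Gr ^ F.Y n B.dd σ), lt_div_iff₀ hposY, mul_assoc,
            mul_comm ((Gr ^ (F.b * σ ^ (2 * n) * F.Msave n σ))⁻¹), ← mul_assoc, ← div_eq_mul_inv, div_lt_one hpos]
          exact hmain
  refine lt_of_eq_of_lt ?_ key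
  rw [hEA]
  unfold FamilyG.X₁ FamilyG.X₂ FamilyG.Msave FamilyG.NA₁ FamilyG.L₁ FamilyG.L₂ FamilyG.P₁ FamilyG.dE FamilyG.gE FamilyG.Dn
  rw [hh₁, Nat.add_sub_cancel]
  ring

/-! ### `AdmissibleParamsG` discharged -/

/-- **`AdmissibleParamsG B dd c` holds for every general-point Baker datum with `dd < n` and every
`c > 0`.** The parameters are those of the exponential family with `ℓ = ⌈c κ^n n!⌉ + 1`,
`b = b₀`, `a = 9(nℓ+1)² + 2b + 2`, base `G = ⌈bigConst⌉`, and `σ` the sum of all thresholds.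
[cite: BakerWustholz2007, §6.8 (p. 119)] -/
theorem admissibleParamsG_of_lt (B : BakerDataG 𝓙 β γ δ) (hdd : B.dd < Fintype.card (β ⊕ (γ ⊕ δ))) {c : ℝ} (hc : 0 < c) :
    AdmissibleParamsG B B.dd c := by
  classical
  set n := Fintype.card (β ⊕ (γ ⊕ δ)) with hn'
  have hn : 1 ≤ n := by omega
  set cg := Fintype.card (Gen β γ δ) with hcg
  -- the ratio `ℓ`
  set K : ℝ := c * ((κD n B.dd : ℕ) : ℝ) ^ n * (n.factorial : ℝ) with hK
  have hK0 : 0 ≤ K := by positivity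
  set ℓ : ℕ := ⌈K⌉₊ + 1 with hℓ
  have hℓ1 : 1 ≤ ℓ := by omega
  have hℓc : K < ℓ := by
    have h1 := Nat.le_ceil K
    rw [hℓ]; push_cast; linarith
  -- the base
  set Gn : ℕ := ⌈B.bigConst⌉₊ with hGn
  have hGG : B.bigConst ≤ Gn := Nat.le_ceil _
  have hG2 : 2 ≤ Gn := by
    have h2 := B.bigConst_spec.1
    have : (2 : ℝ) ≤ (Gn : ℝ) := h2.trans hGG
    exact_mod_cast this
  -- the exponents
  set F₀ : FamilyG := ⟨1, 0, ℓ, Gn, hℓ1, hG2, le_rfl⟩ with hF₀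
  set b : ℕ := F₀.b₀ n B.gens.h cg with hb
  set a : ℕ := 9 * (n * ℓ + 1) ^ 2 + 2 * b + 2 with ha
  have ha1 : 1 ≤ a := by omega
  set F : FamilyG := ⟨a, b, ℓ, Gn, hℓ1, hG2, ha1⟩ with hF
  have hbF : F.b₀ n B.gens.h cg ≤ F.b := le_of_eq rfl
  have haF : 9 * (n * F.ℓ + 1) ^ 2 + 2 * F.b + 2 ≤ F.a := le_of_eq rfl
  have hGGF : B.bigConst ≤ F.G := hGG
  -- thresholds
  set K₀ : ℕ := ⌈K⌉₊ + 1 with hK₀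
  set σ : ℕ := 1 + κD n B.dd + 18 * n * B.gens.h * (n * F.a + F.E₀ n B.dd B.hdeg) +
    F.CD n B.gens.h B.hdeg cg * κD n B.dd + K₀ with hσ
  have hσ1 : 1 ≤ σ := by rw [hσ]; omega
  have hσκ : κD n B.dd ≤ σ := by rw [hσ]; omega
  have hσω : 18 * n * B.gens.h * (n * F.a + F.E₀ n B.dd B.hdeg) ≤ σ := by rw [hσ]; omega
  have hσD : F.CD n B.gens.h B.hdeg cg * κD n B.dd ≤ σ := by rw [hσ]; omega
  have hσK₀ : K₀ ≤ σ := by rw [hσ]; omega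
  have hσK : K ≤ σ := by
    have h1 := Nat.le_ceil K
    have h2 : (K₀ : ℝ) ≤ σ := by exact_mod_cast hσK₀
    rw [hK₀] at h2; push_cast at h2; linarith
  have hΘK : K * (σ : ℝ) ^ n < F.Θ n σ := F.ΘK_lt hn hσ1 hσK
  -- the parameters
  obtain ⟨hR0, hR2⟩ := F.R_bounds n hn hσ1
  refine ⟨F.D' n B.dd σ, F.T n σ, S₀ n σ, F.S n σ, F.T₂ n σ, F.R n σ,
    F.T_pos n hn σ, F.one_le_D' n B.dd hn hσ1, F.one_le_S n hσ1,
    F.siegel_feasible n B.dd hn hσ1, hR0, hR2, ?_, ?_⟩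
  · intro ξ hξ
    exact B.numCond₂_familyG F hn'.symm hn hdd hbF haF hGGF hσ1 hσκ hσω hσD hξ
  · intro e m hm hidx
    exact F.numerics n B.dd hn hdd hc hℓc hσ1 hΘK e m hm hidx

end BakerDataG

end Std

end GaGmEFam

end Literature.NumberTheory.Transcendental

end


/-! ## The engine output at reduced algebraic points -/

noncomputable section

open Module Submodule Complex
open scoped PeriodPair

namespace Literature.NumberTheory.Transcendental

namespace GaGmEFam

namespace Std

open GaGmE (Kbar)
open GaGmE.Std (iy iz is ThetaIdx VanishesAlong Gen)
open LiePresentation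

variable {𝓙 : Type} [Fintype 𝓙] [DecidableEq 𝓙] {β γ δ : Type} [Fintype β] [Fintype γ] [Fintype δ]

/-- **The family general-point engine delivers the engine output at reduced points**: at a reduced point
`w ∈ 𝔟 ∩ Std.Alg` of a `ℚ̄`-rational proper `𝔟` (each `E`-coordinate a vector of `Λ_{cls b}` or without
torsion), for every `c > 0` the Baker engine (`BakerDataG.engine₂` with the parameters of
`BakerDataG.admissibleParamsG_of_lt`) produces a form `P` of degree `D ≥ 1` in the theta functions of the
family standard model with `F_P ≢ 0`, vanishing to order `≥ nT + 1` along `𝔟` at `s·w`, `s ≤ nS` (`S ≥ 1`), whose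
parameters beat `c` in the zero-estimate numerics — the family twin of `GaGmE.Std.engine_of_reduced`.
[cite: BakerWustholz2007, §6.8 (pp. 117–119)] -/
theorem engine_of_reduced [DecidableEq γ] [DecidableEq β] [DecidableEq δ] (L : 𝓙 → PeriodPair) (cls : γ → 𝓙)
    (hL : ∀ i, IsAlgebraic ℚ (L i).g₂ ∧ IsAlgebraic ℚ (L i).g₃) (κM : δ → γ → Kbar)
    {𝔟 : Submodule ℂ (β ⊕ (γ ⊕ δ) → ℂ)} (hrat : IsKRational Kbar 𝔟) (h𝔟 : 𝔟 ≠ ⊤)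
    {w : β ⊕ (γ ⊕ δ) → ℂ} (hw𝔟 : w ∈ 𝔟) (hw : w ∈ Alg L cls κM)
    (hred : ∀ b, w (iz b) ∈ (L (cls b)).lattice ∨ ∀ s : ℕ, s ≠ 0 → (s : ℂ) * w (iz b) ∉ (L (cls b)).lattice)
    {c : ℝ} (hc : 0 < c) :
    ∃ (D S T : ℕ) (P : MvPolynomial (Option β × ThetaIdx γ δ) ℂ), 1 ≤ D ∧ 1 ≤ S ∧
      P.IsHomogeneous D ∧ (∃ w', thetaEval L cls κM P w' ≠ 0) ∧
      (∀ s : ℕ, s ≤ Fintype.card (β ⊕ (γ ⊕ δ)) * S →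
        VanishesAlong 𝔟 (thetaEval L cls κM P) ((s : ℂ) • w) (Fintype.card (β ⊕ (γ ⊕ δ)) * T + 1)) ∧
      ∀ e m : ℕ, m < Fintype.card (β ⊕ (γ ⊕ δ)) →
        Module.finrank ℂ 𝔟 * (Fintype.card (β ⊕ (γ ⊕ δ)) - m) ≤ e * Fintype.card (β ⊕ (γ ⊕ δ)) →
        c * (D : ℝ) ^ Fintype.card (β ⊕ (γ ⊕ δ)) < (Nat.choose (T + e) e : ℝ) * ((S : ℝ) + 1) * (D : ℝ) ^ m ∧
        (Module.finrank ℂ 𝔟 * (Fintype.card (β ⊕ (γ ⊕ δ)) - m) < e * Fintype.card (β ⊕ (γ ⊕ δ)) →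
          c * (D : ℝ) ^ Fintype.card (β ⊕ (γ ⊕ δ)) < (Nat.choose (T + e) e : ℝ) * (D : ℝ) ^ m) := by
  set n := Fintype.card (β ⊕ (γ ⊕ δ)) with hn
  have h𝔟lt : Module.finrank ℂ 𝔟 < n := by
    have := Submodule.finrank_lt h𝔟; simpa [hn] using this
  -- the Baker datum and admissible parameters
  obtain ⟨B, hBL, hBcls, hBκ, hBv, hBdd, hBspan⟩ := exists_bakerDataG L cls hL κM hrat hw hred
  have hdd : B.dd < Fintype.card (β ⊕ (γ ⊕ δ)) := by rw [hBdd]; exact h𝔟lt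
  obtain ⟨D', T, S₀, S, T'', R, hT, hD', hS, hpq, hR0, hR, hnum, hineq⟩ := B.admissibleParamsG_of_lt hdd hc
  -- run the engine
  have hv : B.v ∈ B.bSpan := by
    show B.v ∈ Submodule.span ℂ (Set.range B.xs)
    rw [hBspan, hBv]; exact hw𝔟
  obtain ⟨P, hP, hne, hvan⟩ := B.engine₂ hv D' T S₀ (n * S) (n * T'' + 1) R hT hpq hR0 (by exact_mod_cast hR) hnum
  have hD1 : 1 ≤ n * D' := Nat.one_le_iff_ne_zero.mpr (Nat.mul_ne_zero (by omega) (by omega))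
  refine ⟨n * D', S, T'', P, hD1, hS, hP, ?_, ?_, ?_⟩
  · rwa [hBL, hBcls, hBκ] at hne
  · intro s hs
    have := hvan s hs
    rwa [show B.bSpan = 𝔟 from hBspan, hBL, hBcls, hBκ, hBv] at this
  · intro e m hm hidx
    have hm' : m < Fintype.card (β ⊕ (γ ⊕ δ)) := hn ▸ hm
    have hidx' : B.dd * (Fintype.card (β ⊕ (γ ⊕ δ)) - m) ≤ e * Fintype.card (β ⊕ (γ ⊕ δ)) := by
      rw [hBdd, ← hn]; exact hidx
    have := hineq e m hm' hidx'
    rw [hBdd, ← hn] at this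
    exact this

end Std

end GaGmEFam

end Literature.NumberTheory.Transcendental

end
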